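import Summits.QuantumFields.YangMills.Theorems.ColdStartUniversalityShenZhuZhuW2DiracContractionSU2
import Summits.QuantumFields.YangMills.Theorems.ColdStartUniversalityLatticeLangevinStrongFellerTV
import Summits.QuantumFields.YangMills.Theorems.ColdStartUniversalityUniformColdStartMixingFixedCutoffMixingTimeWindow
import HarnessLib

/-!
# Route `ColdStartUniversality` (fixed-cut-off package): the PRINTED `W₂` form of Shen–Zhu–Zhu's Theorem 4.2 (4.5) and every-start total-variation
# ergodicity AT THE ROUTE'S CUT-OFFS, inside the strong-coupling window `γε_K > 6`:
# `W₂^{ρ_L}(δ_Q P^(K)_t, δ_{Q'} P^(K)_t) ≤ exp(−(1 − 6/(γε_K))·t)·ρ_L(Q,Q')` and `|P^(K)_(t+s)(Q,A) − μ_K(A)| ≤ C_s(K)·exp(−(1 − 6/(γε_K))·t)·√2·π·√#E_K`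

Planner-facing helper file (seat `ym-line-csu-p1`, g42, file G68; `--supports stmt-QuantumFields-24809`).  G65's `szzDiracContraction_W2_su2` and G67's
`wilson_tv_ergodicity_everyStart_diam` at the route's `K`-th cut-off: lattice `(ℤ/L_K)³`, `L_K = (F.P K).sitesPerDir 0`, SZZ coupling `β'_K = (γε_K)⁻¹/2`;
in the window `6 < γε_K` one has `|β'_K| < 1/12` and `1 − 12|β'_K| = 1 − 6/(γε_K)` (`window_coupling_bounds`).

* ★★ `szzDiracContraction_W2_fixedCutoff_window` — for every cut-off `K` with `6 < γε_K`:
  `SZZDiracContraction (fundamentalLatticeRep 2) 3 L_K β'_K (1 − 6/(γε_K)) ρ_L²` — the printed `W₂` contraction (4.5) of the `K`-th SZZ dynamics from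
  ANY two deterministic starts, rate `1 − 6/(γε_K)` per unit LATTICE time;
* ★★ `tv_ergodicity_everyStart_fixedCutoff_window` — for every realising kernel family of the `K`-th dynamics, every start `Q`, measurable `A`, `s > 0`,
  `t ≥ 0`:  `|κ_(t+s)(Q)(A) − μ_K(A)| ≤ √((1 − 6/(γε_K))/(e^(2(1 − 6/(γε_K))s) − 1))·exp(−(1 − 6/(γε_K))·t)·√2·π·√#E_K`.

THEOREMS ONLY, no definition, no sorry.  PLANNER-FACING, HONEST: a WINDOW statement — `6 < γε_K` holds only for the coarse cut-offs (it fails as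
`ε_K → 0` at fixed `γ`), so this is NOT uniform in `K` in the sense of `UniformColdStartMixing` (stmt-24809, ASIDE, NOT restated or weakened); the TV
prefactor grows like `√#E_K`; no crux, rung or summit statement is proved; the Yang–Mills mass gap is NOT proved.
-/

set_option autoImplicit false

noncomputable section

namespace Summit.QuantumFields.YangMills.Theorems.ColdStartUniversality

open MeasureTheory ProbabilityTheory Matrix Complex Finset Filter Topology Set
open scoped ComplexConjugate BigOperators Real NNReal ENNReal
open Literature.Probability.Process Literature.MathematicalPhysics.QuantumFieldTheory
open Literature.MathematicalPhysics.QuantumFieldTheory.Balaban1983to89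
open Literature.MathematicalPhysics.QuantumLattice (fundamentalRep fundamentalLatticeRep continuous_fundamentalRep fundamentalRep_apply fundamentalLatticeRep_N)

/-- ★★ **Shen–Zhu–Zhu's (4.5), `W₂` form, at the route's cut-offs, window `γε_K > 6` (lattice time).**  For every cut-off `K` with `6 < γε_K`:
`SZZDiracContraction (fundamentalLatticeRep 2) 3 L_K β'_K (1 − 6/(γε_K)) (torusRiemannDistSq (fundamentalLatticeRep 2))` — for ANY two strong solutions
of the `K`-th SZZ dynamics (`β'_K = (γε_K)⁻¹/2` on `(ℤ/L_K)³`) from deterministic starts `Q, Q̄` and every lattice time `t`, the coupling infimum of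
`E ρ_L(U_t,U'_t)²` is at most `exp(−2(1 − 6/(γε_K))·t)·ρ_L(Q,Q̄)²`.  The Yang–Mills mass gap is NOT proved. [cite: ShenZhuZhu2022, Theorem 4.2 (4.5)] -/
theorem szzDiracContraction_W2_fixedCutoff_window (F : T3ContinuumYM3Torus.T3Family) (γ : ℝ) (K : ℕ) (hK : 6 < γ * (F.P K).eps) :
    SZZDiracContraction (fundamentalLatticeRep 2) 3 ((F.P K).sitesPerDir 0) ((γ * (F.P K).eps)⁻¹ / 2) (1 - 6 / (γ * (F.P K).eps))
      (torusRiemannDistSq (fundamentalLatticeRep 2)) := by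
  obtain ⟨hβ, hrate⟩ := window_coupling_bounds F γ K hK
  have h := szzDiracContraction_W2_su2 ((F.P K).sitesPerDir 0) ((γ * (F.P K).eps)⁻¹ / 2) hβ
  rw [hrate] at h
  exact h

/-- ★★ **Every-start total-variation ergodicity at the route's cut-offs, window `γε_K > 6`.**  For every cut-off `K` with `6 < γε_K`, every realising
kernel family `κ` of the `K`-th SZZ dynamics, every start `Q`, every measurable `A`, `s > 0` and `t ≥ 0`:
`|κ_(t+s)(Q)(A) − μ_K(A)| ≤ √((1 − 6/(γε_K))/(e^(2(1 − 6/(γε_K))s) − 1))·exp(−(1 − 6/(γε_K))·t)·√2·π·√#E_K` (`μ_K` = the Wilson–Gibbs law at `β'_K`).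
The Yang–Mills mass gap is NOT proved. [cite: ShenZhuZhu2022, Theorem 4.2 (4.5)] -/
theorem tv_ergodicity_everyStart_fixedCutoff_window (F : T3ContinuumYM3Torus.T3Family) (γ : ℝ) (K : ℕ) (hK : 6 < γ * (F.P K).eps)
    (κ : ℝ≥0 → Kernel (GaugeConfig 3 ((F.P K).sitesPerDir 0) (Matrix.specialUnitaryGroup (Fin 2) ℂ))
      (GaugeConfig 3 ((F.P K).sitesPerDir 0) (Matrix.specialUnitaryGroup (Fin 2) ℂ))) [∀ t, IsMarkovKernel (κ t)]
    (hreal : ∀ (t : ℝ≥0) (x : GaugeConfig 3 ((F.P K).sitesPerDir 0) (Matrix.specialUnitaryGroup (Fin 2) ℂ))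
        (Ω : Type) [MeasurableSpace Ω] (P : Measure Ω) [IsProbabilityMeasure P]
        (W : ℝ≥0 → Ω → (Edge 3 ((F.P K).sitesPerDir 0) × NoiseIdx 2 → ℝ)) (hW : IsFlatBrownian W P)
        (U : ℝ≥0 → Ω → GaugeConfig 3 ((F.P K).sitesPerDir 0) (Matrix.specialUnitaryGroup (Fin 2) ℂ)),
        (∀ ω, U 0 ω = x) →
        (latticeLangevinDynamics (fundamentalLatticeRep 2) ((γ * (F.P K).eps)⁻¹ / 2)).IsSolution (fundamentalRep (Fin 2))
          hW.natFiltration P W U →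
        κ t x = P.map (U t))
    (Q : GaugeConfig 3 ((F.P K).sitesPerDir 0) (Matrix.specialUnitaryGroup (Fin 2) ℂ))
    {A : Set (GaugeConfig 3 ((F.P K).sitesPerDir 0) (Matrix.specialUnitaryGroup (Fin 2) ℂ))} (hA : MeasurableSet A)
    {s : ℝ≥0} (hs : 0 < (s : ℝ)) (t : ℝ≥0) :
    |((κ (t + s) Q) A).toReal - ((wilsonMeasure (d := 3) (L := (F.P K).sitesPerDir 0) (fundamentalRep (Fin 2)) ((γ * (F.P K).eps)⁻¹ / 2)) A).toReal| ≤
      Real.sqrt ((1 - 6 / (γ * (F.P K).eps)) / (Real.exp (2 * (1 - 6 / (γ * (F.P K).eps)) * (s : ℝ)) - 1)) *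
        Real.exp (-((1 - 6 / (γ * (F.P K).eps)) * (t : ℝ))) *
        (Real.sqrt 2 * Real.pi * Real.sqrt (Fintype.card (Edge 3 ((F.P K).sitesPerDir 0)))) := by
  obtain ⟨hβ, hrate⟩ := window_coupling_bounds F γ K hK
  have h := wilson_tv_ergodicity_everyStart_diam ((F.P K).sitesPerDir 0) ((γ * (F.P K).eps)⁻¹ / 2) hβ κ hreal Q hA hs t
  rw [hrate] at h
  exact h

end Summit.QuantumFields.YangMills.Theorems.ColdStartUniversality

end
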